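import Mathlib
import HarnessLib
import Literature.Analysis.FluidPDE.KNSSRemark61
import Literature.Analysis.FluidPDE.KNSSTypeIRateLiouvilleMild
import Literature.Analysis.FluidPDE.NSBoundedMildAnalytic
import Literature.Analysis.FluidPDE.OseenMildUniqueness

/-!
# TypeILiouvilleShorelineAnalytic — crux (L) stmt-NavierStokesRegularity-10661 `TypeIliouvilleL`:
# PRINT'S CLASS IS JOINTLY REAL-ANALYTIC; ONE LOCALLY CONSTANT SLICE FORCES A CONSTANT FLOW; FLAT BALLS ESCAPE

Helper for stmt-NavierStokesRegularity-10661 (`--supports`); theorems only, no definitions, no named-fact hypotheses;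
route-independent imports; closes no item; Navier–Stokes regularity is NOT proved here.  Kernel source: the decomp-ns
cell's lens-2 g19 node «THE SHORELINE» (`run/shared/lean/pub/decomp-ns/decomp-ns-lens-2/Shoreline.lean`, critic row 224:
«bank one helper --supports 10661 with defs inlined»), banked DEF-FREE (`InPrintClass`, `LittoralSlice`, `FlatBall`,
`AnchoredSlice` unfolded into binders) by the leafhand seat of the EulerZoomLiouville route.
PRINT'S CLASS P (KNSS 2009 §4 (i)): `v : ℝ → ℝ³ → ℝ³` continuous and bounded on `(−∞,0) × ℝ³` with
`v(t) = e^{(t−s)Δ}v(s) − B¹_s(v,v)(t)` for all `s < t < 0` (weak divergence-freeness is not needed in this file).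
* §1 `classP_analyticOnNhd_uncurry` — every member of P is JOINTLY REAL-ANALYTIC on `(−∞,0) × ℝ³` (local analyticity
  of Oseen's scheme `lemarieRieusset2016_local_analyticity_holds` + uniqueness `oseenMild_bounded_unique`, window by
  window); slices `classP_analyticOnNhd_slice`, trajectories `classP_analyticOnNhd_time`.
* §2 `classP_const_after_of_const_slice`, `classP_const_of_locallyConst_slice` — ONE-SLICE FLOW RIGIDITY: constant on
  ONE nonempty open set of ONE slice `t₀ < 0` ⟹ one constant vector on `(−∞,0) × ℝ³`;
  `classP_nowhere_locallyConst_of_nonconst`.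
* §3 (metric geometry of `ℝ³`) `exists_constBall_of_recurrentFlat`, `exists_constHalfspace_of_recurrentFlat` —
  recurrent `ε`-flatness at bounded range forces a ball / half-space of constancy (compactness).
* §4 `classP_flatBalls_escape_of_nonconst`, `classP_no_settled_halfspaces_of_nonconst` — in a NONCONSTANT member every
  soft use of local Galilean rest frames fails: `ε`-flat `r`-balls leave every bounded region as `ε → 0⁺` (so any
  placement radius `R₀(ε) → ∞`), no settled flat half-spaces.  What a counterexample to (L) can still do is quantified only by RATES.
[cite: LemarieRieusset2016, Thm. 9.12 (PDF p. 260); KochNadirashviliSereginSverak2009, §4 and Remark 6.1 (arXiv:0709.3599)]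
-/


noncomputable section
open MeasureTheory Filter Set Function Metric
open scoped Topology ENNReal InnerProductSpace RealInnerProductSpace
open Literature.Analysis Literature.Analysis.FluidPDE Literature.Analysis.UnboundedOperators
set_option linter.dupNamespace false
namespace Summit.NavierStokesRegularity.NavierStokesRegularity.Theorems.TypeILiouvilleShoreline

/-! ## §1 Joint real-analyticity of print's class -/

/-- **Every member of print's class is jointly real-analytic on `(−∞,0) × ℝ³`.**  Near `(t, x)` it coincides with the
jointly analytic local Oseen solution restarted at `s₁ = t − ½·ε/M²` (`lemarieRieusset2016_local_analyticity_holds`)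
by uniqueness of bounded Oseen-mild solutions (`oseenMild_bounded_unique`) and continuity of the slices.
[cite: LemarieRieusset2016, Thm. 9.12 (PDF p. 260, proof pp. 260–263)] -/
theorem classP_analyticOnNhd_uncurry
    {v : ℝ → EuclideanSpace ℝ (Fin 3) → EuclideanSpace ℝ (Fin 3)}
    (hc : ContinuousOn (uncurry v) (Iio 0 ×ˢ univ))
    (hK : ∃ K : ℝ, ∀ t < 0, ∀ x, ‖v t x‖ ≤ K)
    (hm : ∀ s t : ℝ, s < t → t < 0 → ∀ x,
      v t x = heatExtension (v s) (t - s) x - oseenDuhamel 1 s v v t x) :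
    AnalyticOnNhd ℝ (uncurry v) (Iio (0 : ℝ) ×ˢ (univ : Set (EuclideanSpace ℝ (Fin 3)))) := by
  obtain ⟨ε, hε, C₀, hC₀, hloc⟩ := lemarieRieusset2016_local_analyticity_holds
  obtain ⟨K, hvK⟩ := hK
  -- a positive uniform bound
  set Mb : ℝ := max K 0 + 1 with hMb
  have hMb0 : 0 < Mb := by rw [hMb]; linarith [le_max_right K 0]
  have hnormle : ∀ τ < 0, ∀ x, ‖v τ x‖ ≤ Mb := fun τ hτ x =>
    (hvK τ hτ x).trans ((le_max_left K 0).trans (by rw [hMb]; linarith))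
  have hlen : 0 < ε * 1 / Mb ^ 2 := by positivity
  rintro ⟨t, x⟩ ⟨ht, -⟩
  change t < 0 at ht
  -- the initial time of the analytic window
  set s₁ : ℝ := t - (ε * 1 / Mb ^ 2) / 2 with hs₁
  have hs₁t : s₁ < t := by rw [hs₁]; linarith
  have hs₁0 : s₁ < 0 := by linarith
  have hslice : ∀ {τ : ℝ}, τ < 0 → Continuous (v τ) := fun {τ} hτ =>
    hc.comp_continuous (Continuous.prodMk_right τ) fun x => mem_prod.2 ⟨hτ, mem_univ x⟩
  have ha_meas : AEStronglyMeasurable (v s₁) volume := (hslice hs₁0).aestronglyMeasurable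
  have ha_bd : eLpNorm (v s₁) ∞ volume ≤ ENNReal.ofReal Mb := by
    rw [eLpNorm_exponent_top]
    exact eLpNormEssSup_le_of_ae_bound (Eventually.of_forall fun y => hnormle s₁ hs₁0 y)
  obtain ⟨vl, hvl_an, hvl_eq, hvl_bd⟩ := hloc one_pos s₁ hMb0 ha_meas ha_bd
  -- the common window `(s₁, T₂)`, `T₂ = min (s₁ + ε/Mb²) (t/2) ∋ t`
  set T₂ : ℝ := min (s₁ + ε * 1 / Mb ^ 2) (t / 2) with hT₂
  have htT₂ : t < T₂ := lt_min (by rw [hs₁]; linarith) (by linarith)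
  have hT₂0 : T₂ < 0 := (min_le_right _ _).trans_lt (by linarith)
  have hT₂h : T₂ ≤ s₁ + ε * 1 / Mb ^ 2 := min_le_left _ _
  -- uniqueness of bounded Oseen-mild solutions on the window
  set M' : ℝ := max Mb (C₀ * Mb) with hM'
  have hM'0 : 0 ≤ M' := hMb0.le.trans (le_max_left _ _)
  have hsub : Ioo s₁ T₂ ×ˢ (univ : Set (EuclideanSpace ℝ (Fin 3))) ⊆ Iio 0 ×ˢ univ :=
    prod_mono (fun τ hτ => (hτ.2.trans hT₂0 : τ < 0)) Subset.rfl
  have hum : AEStronglyMeasurable (uncurry v) (volume.restrict (Ioo s₁ T₂ ×ˢ univ)) :=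
    (hc.mono hsub).aestronglyMeasurable (measurableSet_Ioo.prod MeasurableSet.univ)
  have hvlm : AEStronglyMeasurable (uncurry vl) (volume.restrict (Ioo s₁ T₂ ×ˢ univ)) :=
    (hvl_an.continuousOn.mono (prod_mono (Ioo_subset_Ioo_right hT₂h) Subset.rfl)).aestronglyMeasurable
      (measurableSet_Ioo.prod MeasurableSet.univ)
  have huM : ∀ τ ∈ Ioo s₁ T₂, ∀ y, ‖v τ y‖ ≤ M' := fun τ hτ y =>
    (hnormle τ (hτ.2.trans hT₂0) y).trans (le_max_left _ _)
  have hvM : ∀ τ ∈ Ioo s₁ T₂, ∀ y, ‖vl τ y‖ ≤ M' := fun τ hτ y =>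
    (hvl_bd τ ⟨hτ.1, hτ.2.trans_le hT₂h⟩ y).trans (le_max_right _ _)
  have hu : ∀ τ ∈ Ioo s₁ T₂, v τ =ᵐ[volume] fun y =>
      heatExtension (v s₁) (1 * (τ - s₁)) y - oseenDuhamel 1 s₁ v v τ y :=
    fun τ hτ => Eventually.of_forall fun y => by
      rw [one_mul]
      exact hm s₁ τ hτ.1 (hτ.2.trans hT₂0) y
  have hv' : ∀ τ ∈ Ioo s₁ T₂, vl τ =ᵐ[volume] fun y =>
      heatExtension (v s₁) (1 * (τ - s₁)) y - oseenDuhamel 1 s₁ vl vl τ y :=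
    fun τ hτ => Eventually.of_forall fun y => hvl_eq τ ⟨hτ.1, hτ.2.trans_le hT₂h⟩ y
  have heq := oseenMild_bounded_unique
    (U := fun τ y => heatExtension (v s₁) (1 * (τ - s₁)) y)
    one_pos hM'0 hum hvlm huM hvM hu hv'
  -- `v = vl` everywhere on the window (both slices are continuous)
  have hvvl : ∀ τ ∈ Ioo s₁ T₂, v τ = vl τ := by
    intro τ hτ
    have hτwin : τ ∈ Ioo s₁ (s₁ + ε * 1 / Mb ^ 2) := ⟨hτ.1, hτ.2.trans_le hT₂h⟩
    have hvlτ : AnalyticOnNhd ℝ (vl τ) univ := analyticOnNhd_slice hvl_an hτwin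
    exact (Continuous.ae_eq_iff_eq volume (hslice (hτ.2.trans hT₂0))
      (continuousOn_univ.1 hvlτ.continuousOn)).1 (heq τ hτ)
  -- hence `uncurry v = uncurry vl` near `(t, x)`, and `uncurry vl` is analytic there
  have hopen : IsOpen (Ioo s₁ T₂ ×ˢ (univ : Set (EuclideanSpace ℝ (Fin 3)))) := isOpen_Ioo.prod isOpen_univ
  have hmem : ((t, x) : ℝ × EuclideanSpace ℝ (Fin 3)) ∈ Ioo s₁ T₂ ×ˢ (univ : Set (EuclideanSpace ℝ (Fin 3))) :=
    ⟨⟨hs₁t, htT₂⟩, mem_univ _⟩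
  have hev : uncurry vl =ᶠ[𝓝 ((t, x) : ℝ × EuclideanSpace ℝ (Fin 3))] uncurry v := by
    filter_upwards [hopen.mem_nhds hmem] with p hp
    obtain ⟨τ, y⟩ := p
    simp only [uncurry_apply_pair]
    rw [hvvl τ hp.1]
  have han : AnalyticAt ℝ (uncurry vl) ((t, x) : ℝ × EuclideanSpace ℝ (Fin 3)) :=
    hvl_an _ ⟨⟨hs₁t, htT₂.trans_le hT₂h⟩, mem_univ _⟩
  exact han.congr hev

/-- **Slices of a class-P field are real-analytic on `ℝ³`.** [cite: LemarieRieusset2016, Thm. 9.12] -/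
theorem classP_analyticOnNhd_slice
    {v : ℝ → EuclideanSpace ℝ (Fin 3) → EuclideanSpace ℝ (Fin 3)}
    (hc : ContinuousOn (uncurry v) (Iio 0 ×ˢ univ))
    (hK : ∃ K : ℝ, ∀ t < 0, ∀ x, ‖v t x‖ ≤ K)
    (hm : ∀ s t : ℝ, s < t → t < 0 → ∀ x,
      v t x = heatExtension (v s) (t - s) x - oseenDuhamel 1 s v v t x)
    {t : ℝ} (ht : t < 0) : AnalyticOnNhd ℝ (v t) univ :=
  analyticOnNhd_slice (classP_analyticOnNhd_uncurry hc hK hm) (mem_Iio.2 ht)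

/-- **Trajectories `t ↦ v t x` of a class-P field are real-analytic on `(−∞,0)`.** [cite: LemarieRieusset2016, Thm. 9.12] -/
theorem classP_analyticOnNhd_time
    {v : ℝ → EuclideanSpace ℝ (Fin 3) → EuclideanSpace ℝ (Fin 3)}
    (hc : ContinuousOn (uncurry v) (Iio 0 ×ˢ univ))
    (hK : ∃ K : ℝ, ∀ t < 0, ∀ x, ‖v t x‖ ≤ K)
    (hm : ∀ s t : ℝ, s < t → t < 0 → ∀ x,
      v t x = heatExtension (v s) (t - s) x - oseenDuhamel 1 s v v t x)
    (x : EuclideanSpace ℝ (Fin 3)) : AnalyticOnNhd ℝ (fun t => v t x) (Iio 0) := by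
  intro t ht
  have hz : AnalyticAt ℝ (uncurry v) ((t, x) : ℝ × EuclideanSpace ℝ (Fin 3)) :=
    classP_analyticOnNhd_uncurry hc hK hm (t, x) ⟨ht, mem_univ _⟩
  have hι : AnalyticAt ℝ (fun τ : ℝ => ((τ, x) : ℝ × EuclideanSpace ℝ (Fin 3))) t :=
    analyticAt_id.prod analyticAt_const
  exact hz.comp_of_eq hι rfl

/-! ## §2 One-slice flow rigidity -/

/-- Identity theorem: an everywhere real-analytic map `ℝ³ → ℝ³` constant on a nonempty open set is constant. [folklore] -/
theorem const_of_analyticOnNhd_of_locallyConst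
    {w : EuclideanSpace ℝ (Fin 3) → EuclideanSpace ℝ (Fin 3)} (hw : AnalyticOnNhd ℝ w univ)
    {U : Set (EuclideanSpace ℝ (Fin 3))} (hUo : IsOpen U) (hUne : U.Nonempty) {b : EuclideanSpace ℝ (Fin 3)}
    (hb : ∀ x ∈ U, w x = b) : ∀ x, w x = b := by
  obtain ⟨z₀, hz₀⟩ := hUne
  intro x
  have hev : w =ᶠ[𝓝 z₀] fun _ => b := by
    filter_upwards [hUo.mem_nhds hz₀] with y hy using hb y hy
  exact hw.eqOn_of_preconnected_of_eventuallyEq analyticOnNhd_const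
    (convex_univ (𝕜 := ℝ) (E := EuclideanSpace ℝ (Fin 3))).isPreconnected (mem_univ z₀) hev (mem_univ x)

/-- FORWARD RIGIDITY: a class-P field constant `= b` on the slice `t₀` equals `b` on every later negative slice
(uniqueness of bounded Oseen-mild solutions from the datum `v t₀ ≡ b` against the constant solution:
`heatExtension_const`, `oseenDuhamel_eq_zero_of_const`). [cite: KochNadirashviliSereginSverak2009, Remark 6.1 (arXiv:0709.3599)] -/
theorem classP_const_after_of_const_slice
    {v : ℝ → EuclideanSpace ℝ (Fin 3) → EuclideanSpace ℝ (Fin 3)}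
    (hc : ContinuousOn (uncurry v) (Iio 0 ×ˢ univ))
    (hK : ∃ K : ℝ, ∀ t < 0, ∀ x, ‖v t x‖ ≤ K)
    (hm : ∀ s t : ℝ, s < t → t < 0 → ∀ x,
      v t x = heatExtension (v s) (t - s) x - oseenDuhamel 1 s v v t x)
    {t₀ : ℝ} {b : EuclideanSpace ℝ (Fin 3)} (hb : ∀ x, v t₀ x = b) :
    ∀ t ∈ Ioo t₀ 0, ∀ x, v t x = b := by
  obtain ⟨K, hvK⟩ := hK
  set M : ℝ := max K ‖b‖ with hM
  have hM0 : 0 ≤ M := (norm_nonneg b).trans (le_max_right _ _)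
  have hsub : Ioo t₀ 0 ×ˢ (univ : Set (EuclideanSpace ℝ (Fin 3))) ⊆ Iio 0 ×ˢ univ :=
    prod_mono Ioo_subset_Iio_self Subset.rfl
  have hum : AEStronglyMeasurable (uncurry v) (volume.restrict (Ioo t₀ 0 ×ˢ univ)) :=
    (hc.mono hsub).aestronglyMeasurable (measurableSet_Ioo.prod MeasurableSet.univ)
  have hcm : AEStronglyMeasurable (uncurry fun (_ : ℝ) (_ : EuclideanSpace ℝ (Fin 3)) => b)
      (volume.restrict (Ioo t₀ 0 ×ˢ (univ : Set (EuclideanSpace ℝ (Fin 3))))) :=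
    aestronglyMeasurable_const
  have huM : ∀ τ ∈ Ioo t₀ 0, ∀ y, ‖v τ y‖ ≤ M := fun τ hτ y => (hvK τ hτ.2 y).trans (le_max_left _ _)
  have hbM : ∀ τ ∈ Ioo t₀ 0, ∀ y : EuclideanSpace ℝ (Fin 3),
      ‖(fun (_ : ℝ) (_ : EuclideanSpace ℝ (Fin 3)) => b) τ y‖ ≤ M :=
    fun _ _ _ => le_max_right _ _
  have hu : ∀ τ ∈ Ioo t₀ 0, v τ =ᵐ[volume] fun y =>
      heatExtension (v t₀) (1 * (τ - t₀)) y - oseenDuhamel 1 t₀ v v τ y :=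
    fun τ hτ => Eventually.of_forall fun y => by
      rw [one_mul]
      exact hm t₀ τ hτ.1 hτ.2 y
  have hvt₀ : v t₀ = fun _ => b := funext hb
  have hcb : ∀ τ ∈ Ioo t₀ 0, (fun (_ : ℝ) (_ : EuclideanSpace ℝ (Fin 3)) => b) τ =ᵐ[volume] fun y =>
      heatExtension (v t₀) (1 * (τ - t₀)) y -
        oseenDuhamel 1 t₀ (fun (_ : ℝ) (_ : EuclideanSpace ℝ (Fin 3)) => b)
          (fun (_ : ℝ) (_ : EuclideanSpace ℝ (Fin 3)) => b) τ y := by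
    intro τ hτ
    refine Eventually.of_forall fun y => ?_
    have hσ : 0 < 1 * (τ - t₀) := by rw [one_mul]; linarith [hτ.1]
    have hD : oseenDuhamel 1 t₀ (fun (_ : ℝ) (_ : EuclideanSpace ℝ (Fin 3)) => b)
        (fun (_ : ℝ) (_ : EuclideanSpace ℝ (Fin 3)) => b) τ y = 0 :=
      oseenDuhamel_eq_zero_of_const (b := fun _ => b) (c := fun _ => b)
        (fun _ _ _ => rfl) (fun _ _ _ => rfl) y
    simp only
    rw [hvt₀, heatExtension_const b hσ y, hD, sub_zero]
  have key := oseenMild_bounded_unique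
    (U := fun τ y => heatExtension (v t₀) (1 * (τ - t₀)) y) one_pos hM0 hum hcm huM hbM hu hcb
  intro t ht x
  have hae : v t =ᵐ[volume] fun _ => b := key t ht
  have heq : v t = fun _ => b :=
    (Continuous.ae_eq_iff_eq volume
      (hc.comp_continuous (Continuous.prodMk_right t) fun x => mem_prod.2 ⟨ht.2, mem_univ x⟩)
      continuous_const).1 hae
  exact congrFun heq x

/-- **ONE-SLICE FLOW RIGIDITY.**  A class-P field which is constant on ONE nonempty open set of ONE slice `t₀ < 0`
is one constant vector on all of `(−∞,0) × ℝ³` (identity theorem on the analytic slice; forward rigidity; backward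
by analyticity of trajectories and the identity theorem on the preconnected `(−∞,0)`).
[cite: LemarieRieusset2016, Thm. 9.12; KochNadirashviliSereginSverak2009, Remark 6.1] -/
theorem classP_const_of_locallyConst_slice
    {v : ℝ → EuclideanSpace ℝ (Fin 3) → EuclideanSpace ℝ (Fin 3)}
    (hc : ContinuousOn (uncurry v) (Iio 0 ×ˢ univ))
    (hK : ∃ K : ℝ, ∀ t < 0, ∀ x, ‖v t x‖ ≤ K)
    (hm : ∀ s t : ℝ, s < t → t < 0 → ∀ x,
      v t x = heatExtension (v s) (t - s) x - oseenDuhamel 1 s v v t x)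
    {t₀ : ℝ} (ht₀ : t₀ < 0) {U : Set (EuclideanSpace ℝ (Fin 3))} (hUo : IsOpen U) (hUne : U.Nonempty)
    {b : EuclideanSpace ℝ (Fin 3)} (hb : ∀ x ∈ U, v t₀ x = b) :
    ∀ t < 0, ∀ x, v t x = b := by
  have hb' : ∀ x, v t₀ x = b :=
    const_of_analyticOnNhd_of_locallyConst (classP_analyticOnNhd_slice hc hK hm ht₀) hUo hUne hb
  have hfwd := classP_const_after_of_const_slice hc hK hm hb'
  intro t ht x
  have han := classP_analyticOnNhd_time hc hK hm x
  have hz₀ : t₀ / 2 ∈ Ioo t₀ 0 := ⟨by linarith, by linarith⟩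
  have hev : (fun τ => v τ x) =ᶠ[𝓝 (t₀ / 2)] fun _ => b := by
    filter_upwards [isOpen_Ioo.mem_nhds hz₀] with τ hτ using hfwd τ hτ x
  exact han.eqOn_of_preconnected_of_eventuallyEq analyticOnNhd_const (convex_Iio (0 : ℝ)).isPreconnected
    (mem_Iio.2 hz₀.2) hev (mem_Iio.2 ht)

/-- Contrapositive: a NONCONSTANT class-P field is NOWHERE LOCALLY CONSTANT on EVERY slice — no nonempty open set of
constancy at any `t < 0`. [cite: LemarieRieusset2016, Thm. 9.12] -/
theorem classP_nowhere_locallyConst_of_nonconst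
    {v : ℝ → EuclideanSpace ℝ (Fin 3) → EuclideanSpace ℝ (Fin 3)}
    (hc : ContinuousOn (uncurry v) (Iio 0 ×ˢ univ))
    (hK : ∃ K : ℝ, ∀ t < 0, ∀ x, ‖v t x‖ ≤ K)
    (hm : ∀ s t : ℝ, s < t → t < 0 → ∀ x,
      v t x = heatExtension (v s) (t - s) x - oseenDuhamel 1 s v v t x)
    (hnc : ¬ ∃ b : EuclideanSpace ℝ (Fin 3), ∀ t < 0, ∀ x, v t x = b) {t : ℝ} (ht : t < 0)
    {U : Set (EuclideanSpace ℝ (Fin 3))} (hUo : IsOpen U) (hUne : U.Nonempty) (b : EuclideanSpace ℝ (Fin 3)) :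
    ∃ x ∈ U, v t x ≠ b := by
  by_contra hcon
  push Not at hcon
  exact hnc ⟨b, classP_const_of_locallyConst_slice hc hK hm ht hUo hUne hcon⟩

/-! ## §3 The shoreline lemmas (pure metric geometry of `ℝ³`) -/

/-- **RECURRENT FLATNESS AT BOUNDED RANGE FORCES A BALL OF CONSTANCY.**  If for every `ε > 0` some `r`-ball centred
within distance `D` of `x₀` carries oscillation `≤ ε` (`‖w x − w y‖ ≤ ε` for `x, y` in the ball), then some `r`-ball
centred within distance `D` of `x₀` is a ball of constancy (centres accumulate in the compact `closedBall x₀ D`).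
[folklore] -/
theorem exists_constBall_of_recurrentFlat
    {w : EuclideanSpace ℝ (Fin 3) → EuclideanSpace ℝ (Fin 3)} {x₀ : EuclideanSpace ℝ (Fin 3)} {D r : ℝ}
    (hrec : ∀ ε : ℝ, 0 < ε → ∃ h : EuclideanSpace ℝ (Fin 3), dist h x₀ ≤ D ∧
      ∀ x y : EuclideanSpace ℝ (Fin 3), dist x h < r → dist y h < r → ‖w x - w y‖ ≤ ε) :
    ∃ h : EuclideanSpace ℝ (Fin 3), dist h x₀ ≤ D ∧
      ∀ x y : EuclideanSpace ℝ (Fin 3), dist x h < r → dist y h < r → w x = w y := by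
  choose! c hcD hcF using hrec
  have hpos : ∀ n : ℕ, (0 : ℝ) < 1 / ((n : ℝ) + 1) := fun n => Nat.one_div_pos_of_nat
  set u : ℕ → EuclideanSpace ℝ (Fin 3) := fun n => c (1 / ((n : ℝ) + 1)) with hu
  have hmem : ∀ n, u n ∈ closedBall x₀ D := fun n => mem_closedBall.2 (hcD _ (hpos n))
  obtain ⟨h, hhD, φ, hφ, hlim⟩ := (isCompact_closedBall x₀ D).tendsto_subseq hmem
  refine ⟨h, mem_closedBall.1 hhD, fun x y hx hy => ?_⟩
  have key : ∀ δ : ℝ, 0 < δ → ‖w x - w y‖ ≤ δ := by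
    intro δ hδ
    obtain ⟨N, hN⟩ := exists_nat_one_div_lt hδ
    have hg0 : 0 < r - max (dist x h) (dist y h) := sub_pos.2 (max_lt hx hy)
    obtain ⟨N₁, hN₁⟩ := Metric.tendsto_atTop.1 hlim _ hg0
    set n : ℕ := max N N₁ with hn
    have hdn : dist (u (φ n)) h < r - max (dist x h) (dist y h) := hN₁ n (le_max_right _ _)
    have hxn : dist x (u (φ n)) < r :=
      calc dist x (u (φ n)) ≤ dist x h + dist (u (φ n)) h := dist_triangle_right _ _ _
        _ < max (dist x h) (dist y h) + (r - max (dist x h) (dist y h)) :=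
          add_lt_add_of_le_of_lt (le_max_left _ _) hdn
        _ = r := by ring
    have hyn : dist y (u (φ n)) < r :=
      calc dist y (u (φ n)) ≤ dist y h + dist (u (φ n)) h := dist_triangle_right _ _ _
        _ < max (dist x h) (dist y h) + (r - max (dist x h) (dist y h)) :=
          add_lt_add_of_le_of_lt (le_max_right _ _) hdn
        _ = r := by ring
    calc ‖w x - w y‖ ≤ 1 / ((φ n : ℝ) + 1) := hcF _ (hpos (φ n)) x y hxn hyn
      _ ≤ 1 / ((N : ℝ) + 1) := Nat.one_div_le_one_div ((le_max_left N N₁).trans (hφ.id_le n))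
      _ ≤ δ := hN.le
  by_contra hne
  have hp : 0 < ‖w x - w y‖ := norm_pos_iff.2 (sub_ne_zero.2 hne)
  have := key (‖w x - w y‖ / 2) (half_pos hp)
  linarith

/-- **FLAT HALF-SPACES AT BOUNDED DISTANCE FORCE CONSTANCY ON A HALF-SPACE.**  If for every `ε > 0` the map oscillates
by `≤ ε` on a closed half-space `{d ≤ ⟪x − x₀, e⟫}` with `‖e‖ = 1` and `d ≤ D`, then it is constant on an open
half-space `{D < ⟪x − x₀, e∞⟫}` (unit normals accumulate on the compact unit sphere). [folklore] -/
theorem exists_constHalfspace_of_recurrentFlat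
    {w : EuclideanSpace ℝ (Fin 3) → EuclideanSpace ℝ (Fin 3)} {x₀ : EuclideanSpace ℝ (Fin 3)} {D : ℝ}
    (hrec : ∀ ε : ℝ, 0 < ε → ∃ e : EuclideanSpace ℝ (Fin 3), ‖e‖ = 1 ∧ ∃ d : ℝ, d ≤ D ∧
      ∀ x y : EuclideanSpace ℝ (Fin 3), d ≤ ⟪x - x₀, e⟫_ℝ → d ≤ ⟪y - x₀, e⟫_ℝ → ‖w x - w y‖ ≤ ε) :
    ∃ e : EuclideanSpace ℝ (Fin 3), ‖e‖ = 1 ∧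
      ∀ x y : EuclideanSpace ℝ (Fin 3), D < ⟪x - x₀, e⟫_ℝ → D < ⟪y - x₀, e⟫_ℝ → w x = w y := by
  choose! e heN d hdD hflat using hrec
  have hpos : ∀ n : ℕ, (0 : ℝ) < 1 / ((n : ℝ) + 1) := fun n => Nat.one_div_pos_of_nat
  set u : ℕ → EuclideanSpace ℝ (Fin 3) := fun n => e (1 / ((n : ℝ) + 1)) with hu
  have hmem : ∀ n, u n ∈ sphere (0 : EuclideanSpace ℝ (Fin 3)) 1 := fun n =>
    mem_sphere_zero_iff_norm.2 (heN _ (hpos n))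
  obtain ⟨e₁, he₁, φ, hφ, hlim⟩ := (isCompact_sphere (0 : EuclideanSpace ℝ (Fin 3)) 1).tendsto_subseq hmem
  refine ⟨e₁, mem_sphere_zero_iff_norm.1 he₁, fun x y hx hy => ?_⟩
  have hix : Tendsto (fun n => ⟪x - x₀, (u ∘ φ) n⟫_ℝ) atTop (𝓝 ⟪x - x₀, e₁⟫_ℝ) :=
    tendsto_const_nhds.inner hlim
  have hiy : Tendsto (fun n => ⟪y - x₀, (u ∘ φ) n⟫_ℝ) atTop (𝓝 ⟪y - x₀, e₁⟫_ℝ) :=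
    tendsto_const_nhds.inner hlim
  have hex : ∀ᶠ n in atTop, D < ⟪x - x₀, (u ∘ φ) n⟫_ℝ := hix.eventually (lt_mem_nhds hx)
  have hey : ∀ᶠ n in atTop, D < ⟪y - x₀, (u ∘ φ) n⟫_ℝ := hiy.eventually (lt_mem_nhds hy)
  have key : ∀ δ : ℝ, 0 < δ → ‖w x - w y‖ ≤ δ := by
    intro δ hδ
    obtain ⟨N, hN⟩ := exists_nat_one_div_lt hδ
    obtain ⟨n, hnN, hxn, hyn⟩ := ((eventually_ge_atTop N).and (hex.and hey)).exists
    have hεn := hpos (φ n)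
    calc ‖w x - w y‖ ≤ 1 / ((φ n : ℝ) + 1) :=
          hflat _ hεn x y ((hdD _ hεn).trans hxn.le) ((hdD _ hεn).trans hyn.le)
      _ ≤ 1 / ((N : ℝ) + 1) := Nat.one_div_le_one_div (hnN.trans (hφ.id_le n))
      _ ≤ δ := hN.le
  by_contra hne
  have hp : 0 < ‖w x - w y‖ := norm_pos_iff.2 (sub_ne_zero.2 hne)
  have := key (‖w x - w y‖ / 2) (half_pos hp)
  linarith

/-! ## §4 Escape of flat balls and flat half-spaces in nonconstant members of print's class -/

/-- **FLAT BALLS ESCAPE.**  For a NONCONSTANT class-P field, on every slice `t < 0`, for every base point `x₀`, range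
`D` and scale `r > 0` there is `ε > 0` such that NO `r`-ball centred within distance `D` of `x₀` carries oscillation
`≤ ε`. [cite: LemarieRieusset2016, Thm. 9.12] -/
theorem classP_flatBalls_escape_of_nonconst
    {v : ℝ → EuclideanSpace ℝ (Fin 3) → EuclideanSpace ℝ (Fin 3)}
    (hc : ContinuousOn (uncurry v) (Iio 0 ×ˢ univ))
    (hK : ∃ K : ℝ, ∀ t < 0, ∀ x, ‖v t x‖ ≤ K)
    (hm : ∀ s t : ℝ, s < t → t < 0 → ∀ x,
      v t x = heatExtension (v s) (t - s) x - oseenDuhamel 1 s v v t x)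
    (hnc : ¬ ∃ b : EuclideanSpace ℝ (Fin 3), ∀ t < 0, ∀ x, v t x = b) {t : ℝ} (ht : t < 0)
    (x₀ : EuclideanSpace ℝ (Fin 3)) (D : ℝ) {r : ℝ} (hr : 0 < r) :
    ∃ ε : ℝ, 0 < ε ∧ ∀ h : EuclideanSpace ℝ (Fin 3), dist h x₀ ≤ D →
      ∃ x y : EuclideanSpace ℝ (Fin 3), dist x h < r ∧ dist y h < r ∧ ε < ‖v t x - v t y‖ := by
  by_contra hcon
  push Not at hcon
  obtain ⟨h, -, hconst⟩ := exists_constBall_of_recurrentFlat (w := v t) (x₀ := x₀) (D := D) (r := r)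
    fun ε hε => by
      obtain ⟨h, hhD, hflat⟩ := hcon ε hε
      exact ⟨h, hhD, fun x y hx hy => hflat x y hx hy⟩
  obtain ⟨x, hx, hne⟩ := classP_nowhere_locallyConst_of_nonconst hc hK hm hnc ht isOpen_ball
    ⟨h, mem_ball_self hr⟩ (v t h)
  exact hne (hconst x h (mem_ball.1 hx) (by rw [dist_self]; exact hr))

/-- **NO SETTLED FLAT HALF-SPACES.**  In a nonconstant class-P field, on every slice `t < 0`, for every `x₀` and `D`
there is `ε > 0` such that no closed half-space `{d ≤ ⟪x − x₀, e⟫}` with `‖e‖ = 1`, `d ≤ D` carries oscillation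
`≤ ε`. [cite: LemarieRieusset2016, Thm. 9.12] -/
theorem classP_no_settled_halfspaces_of_nonconst
    {v : ℝ → EuclideanSpace ℝ (Fin 3) → EuclideanSpace ℝ (Fin 3)}
    (hc : ContinuousOn (uncurry v) (Iio 0 ×ˢ univ))
    (hK : ∃ K : ℝ, ∀ t < 0, ∀ x, ‖v t x‖ ≤ K)
    (hm : ∀ s t : ℝ, s < t → t < 0 → ∀ x,
      v t x = heatExtension (v s) (t - s) x - oseenDuhamel 1 s v v t x)
    (hnc : ¬ ∃ b : EuclideanSpace ℝ (Fin 3), ∀ t < 0, ∀ x, v t x = b) {t : ℝ} (ht : t < 0)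
    (x₀ : EuclideanSpace ℝ (Fin 3)) (D : ℝ) :
    ∃ ε : ℝ, 0 < ε ∧ ∀ e : EuclideanSpace ℝ (Fin 3), ‖e‖ = 1 → ∀ d : ℝ, d ≤ D →
      ∃ x y : EuclideanSpace ℝ (Fin 3), d ≤ ⟪x - x₀, e⟫_ℝ ∧ d ≤ ⟪y - x₀, e⟫_ℝ ∧ ε < ‖v t x - v t y‖ := by
  by_contra hcon
  push Not at hcon
  obtain ⟨e₁, he₁, hconst⟩ := exists_constHalfspace_of_recurrentFlat (w := v t) (x₀ := x₀) (D := D)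
    fun ε hε => by
      obtain ⟨e, he, d, hd, hflat⟩ := hcon ε hε
      exact ⟨e, he, d, hd, fun x y hx hy => hflat x y hx hy⟩
  -- the witness point `x₀ + (|D| + 1) • e₁` lies in the open half-space
  set z : EuclideanSpace ℝ (Fin 3) := x₀ + (|D| + 1) • e₁ with hz
  have hze : ⟪z - x₀, e₁⟫_ℝ = |D| + 1 := by
    rw [hz, add_sub_cancel_left, real_inner_smul_left, real_inner_self_eq_norm_sq, he₁]
    ring
  have hzD : D < ⟪z - x₀, e₁⟫_ℝ := by rw [hze]; linarith [le_abs_self D]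
  have hopen : IsOpen {x : EuclideanSpace ℝ (Fin 3) | D < ⟪x - x₀, e₁⟫_ℝ} :=
    isOpen_lt continuous_const ((continuous_id.sub continuous_const).inner continuous_const)
  obtain ⟨x, hx, hne⟩ := classP_nowhere_locallyConst_of_nonconst hc hK hm hnc ht hopen ⟨z, hzD⟩ (v t z)
  exact hne (hconst x z hx hzD)

end Summit.NavierStokesRegularity.NavierStokesRegularity.Theorems.TypeILiouvilleShoreline

end
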